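import Literature.Topology.FourManifolds.CobordismAttachment
import Literature.Topology.FourManifolds.CollarExtension
import HarnessLib

/-!
# Pasting a diffeomorphism of an attached cobordism with the identity of the other piece

Topic `Literature/Topology/FourManifolds`.  Everything here is PROVED; no named facts, no
definitions.

Let `V = W ∪_ψ X` be a manifold with boundary obtained by attaching a cobordism `X` from `M`
to `N` to a manifold with boundary `W` along `ψ : ∂W ≅ M`
(`Literature.Topology.FourManifolds.CobordismAttachment b X ψ V`, `CobordismAttachment.lean`:
smooth embeddings `jW : W → V`, `jX : X → V` covering `V` and meeting exactly along
`∂W ≡_ψ M`).  If `G₁` is a self-diffeomorphism of `X` which is THE IDENTITY ON A NEIGHBOURHOOD of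
the incoming end `inl(M)`, then `G₁` and `id_W` paste to a self-diffeomorphism `Φ` of `V`:
`Φ ∘ jX = jX ∘ G₁`, `Φ ∘ jW = jW` (`CobordismAttachment.exists_diffeomorph_apply_jX_eq`).  The
pasted map is the identity near the compact piece `jW(W)` (namely off the compact set
`jX(X ∖ U)`), and off the seam it is smooth by **descent of smoothness along the open immersion
`jX`** (the tree's `contMDiffAt_of_comp_isImmersionAt_of_nhds`, `CollarExtension.lean`;
Kosinski, *Differential Manifolds* (1993), VI.1: the smooth structure of a gluing is "the unique
structure for which the projections are diffeomorphisms" onto their images), `jX` being open at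
every point off `inl(M)` (`CobordismAttachment.image_jX_mem_nhds`).  This is the pasting
`id_W ∪ G₁` by which a diffeomorphism of the cobordism `X`, straightened near `M`
(`CobordismEndStraightening.lean`), is extended over `V` — e.g. Akbulut–Ruberman (2016), §3,
extension of boundary diffeomorphisms over `V′ = X ∪_f W`.

## References

* A. Kosinski, *Differential Manifolds*, Academic Press (1993), Ch. VI §1, proof of Thm. (1.1).
  [Kosinski1993]
* J. Milnor, *Lectures on the h-cobordism theorem* (1965), §1, Thm. 1.4. [MilnorHCobordism1965]
* S. Akbulut, D. Ruberman, *Absolutely exotic compact 4-manifolds*, Comment. Math. Helv. 91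
  (2016), §3. [AkbulutRuberman2016]
-/

noncomputable section

open scoped Manifold ContDiff Topology
open Function Set Filter

namespace Literature.Topology.FourManifolds

namespace CobordismAttachment

universe u v

variable {n : ℕ} {W : Type u} [TopologicalSpace W] [ChartedSpace (EuclideanHalfSpace (n + 1)) W]
  {M N : Type u} [TopologicalSpace M] [ChartedSpace (EuclideanSpace ℝ (Fin n)) M]
  [TopologicalSpace N] [ChartedSpace (EuclideanSpace ℝ (Fin n)) N]
  {b : BoundaryData (𝓡∂ (n + 1)) W (𝓡 n)} {X : Cobordism n M N}
  {ψ : b.carrier ≃ₘ⟮𝓡 n, 𝓡 n⟯ M} {V : Type v} [TopologicalSpace V]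
  [ChartedSpace (EuclideanHalfSpace (n + 1)) V]

/-- A point `jX x` of an attachment `V = W ∪_ψ X` lies on the seam `jW(W)` exactly when `x`
lies on the incoming end of `X`. [cite: MilnorHCobordism1965, §1, Thm. 1.4] -/
theorem jX_mem_range_jW_iff (A : CobordismAttachment b X ψ V) (x : X.W) :
    A.jX x ∈ range A.jW ↔ x ∈ range X.inl := by
  constructor
  · rintro ⟨w, hw⟩
    obtain ⟨z, -, rfl⟩ := (A.jW_eq_jX_iff w x).1 hw
    exact mem_range_self _
  · rintro ⟨m, rfl⟩
    refine ⟨b.incl (ψ.symm m), ?_⟩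
    rw [A.jW_incl, Diffeomorph.apply_symm_apply]

/-- **The embedding of `X` is open at every point off the incoming end**: for `x ∉ inl(M)`,
`jX` maps neighbourhoods of `x` to neighbourhoods of `jX x` in `V` (off the seam, `jX(X)` is the
open complement of the compact piece `jW(W)`). [folklore] -/
theorem image_jX_mem_nhds [CompactSpace W] [CompactSpace M] [T2Space V]
    (A : CobordismAttachment b X ψ V) {x : X.W} (hx : x ∉ range X.inl) {U : Set X.W}
    (hU : U ∈ 𝓝 x) : A.jX '' U ∈ 𝓝 (A.jX x) := by
  -- shrink `U` to an open set missing the (closed) incoming end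
  have hcl : IsClosed (range X.inl) := (isCompact_range X.continuous_inl).isClosed
  obtain ⟨U', hU'U, hU'o, hxU'⟩ := mem_nhds_iff.1 (inter_mem hU (hcl.isOpen_compl.mem_nhds hx))
  -- `jX '' U'` is open in `V`
  obtain ⟨O, hO, hOU'⟩ := A.isSmoothEmbedding_jX.isEmbedding.isInducing.isOpen_iff.1 hU'o
  have hΩ : IsOpen (range A.jW)ᶜ := (isCompact_range A.continuous_jW).isClosed.isOpen_compl
  have himg : A.jX '' U' = O ∩ (range A.jW)ᶜ := by
    apply Subset.antisymm
    · rintro _ ⟨x', hx', rfl⟩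
      refine ⟨?_, fun h => (hU'U hx').2 ((A.jX_mem_range_jW_iff x').1 h)⟩
      have : x' ∈ A.jX ⁻¹' O := by rw [hOU']; exact hx'
      exact this
    · rintro q ⟨hqO, hqW⟩
      rcases A.exists_jW_eq_or q with ⟨w, rfl⟩ | ⟨x', rfl⟩
      · exact (hqW (mem_range_self w)).elim
      · refine ⟨x', ?_, rfl⟩
        rw [← hOU']
        exact hqO
  refine mem_of_superset ((hO.inter hΩ).mem_nhds ?_) ?_
  · rw [← himg]
    exact mem_image_of_mem _ hxU'
  · rw [← himg]
    exact image_mono fun x' hx' => (hU'U hx').1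

/-- **Pasting a diffeomorphism of `X`, the identity near the incoming end, with the identity of
`W`: the smooth map.**  For `T` a self-diffeomorphism of `X` which is the identity on an open
neighbourhood `U` of `inl(M)`, the map `jX x ↦ jX (T x)`, `p ↦ p` off `jX(X)` is well defined and
`C^∞` on `V = W ∪_ψ X`: it is the identity near `jW(W)` (namely off the compact set
`jX(X ∖ U)`), and near `jX x`, `x ∉ inl(M)`, it is smooth by descent along the open immersion
`jX` (`contMDiffAt_of_comp_isImmersionAt_of_nhds`; Kosinski (1993), VI.1).
[cite: Kosinski1993, Ch. VI §1, proof of Thm (1.1)] -/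
theorem exists_contMDiff_apply_jX_eq [CompactSpace W] [CompactSpace M] [T2Space V]
    [IsManifold (𝓡∂ (n + 1)) ∞ V] (A : CobordismAttachment b X ψ V)
    (T : X.W ≃ₘ⟮𝓡∂ (n + 1), 𝓡∂ (n + 1)⟯ X.W) {U : Set X.W} (hU : IsOpen U)
    (hMU : range X.inl ⊆ U) (hT : ∀ p ∈ U, T p = p) :
    ∃ Φ : V → V, ContMDiff (𝓡∂ (n + 1)) (𝓡∂ (n + 1)) ∞ Φ ∧ (∀ x, Φ (A.jX x) = A.jX (T x)) ∧
      ∀ p, p ∉ range A.jX → Φ p = p := by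
  classical
  set Φ : V → V := fun p => if h : p ∈ range A.jX then A.jX (T (Classical.choose h)) else p
    with hΦdef
  have hX : ∀ x, Φ (A.jX x) = A.jX (T x) := fun x => by
    have h : A.jX x ∈ range A.jX := mem_range_self x
    simp only [hΦdef, dif_pos h]
    rw [A.injective_jX (Classical.choose_spec h)]
  have hout : ∀ p, p ∉ range A.jX → Φ p = p := fun p hp => by simp only [hΦdef, dif_neg hp]
  refine ⟨Φ, fun p => ?_, hX, hout⟩
  -- the identity on the open complement of the compact set `jX(X ∖ U)`
  have hK : IsCompact (A.jX '' Uᶜ) := (hU.isClosed_compl.isCompact).image A.continuous_jX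
  have hid : ∀ q ∈ (A.jX '' Uᶜ)ᶜ, Φ q = q := by
    intro q hq
    by_cases hqX : q ∈ range A.jX
    · obtain ⟨x', rfl⟩ := hqX
      have hx'U : x' ∈ U := by
        by_contra h
        exact hq ⟨x', h, rfl⟩
      rw [hX, hT x' hx'U]
    · exact hout q hqX
  by_cases hp : p ∈ A.jX '' Uᶜ
  · -- `p = jX x` with `x ∉ U ⊇ inl(M)`: descent along `jX`
    obtain ⟨x, hxU, rfl⟩ := hp
    have hx : x ∉ range X.inl := fun h => hxU (hMU h)
    exact contMDiffAt_of_comp_isImmersionAt_of_nhds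
      (A.isSmoothEmbedding_jX.isImmersion.isImmersionAt x) (fun U' hU' => A.image_jX_mem_nhds hx hU')
      ((A.isSmoothEmbedding_jX.contMDiff.comp T.contMDiff).contMDiffAt) hX
  · have hev : Φ =ᶠ[𝓝 p] id :=
      eventuallyEq_of_mem (hK.isClosed.isOpen_compl.mem_nhds hp) hid
    exact contMDiffAt_id.congr_of_eventuallyEq hev

/-- **Pasting a diffeomorphism of `X`, the identity near the incoming end, with the identity of
`W`.**  Let `V = W ∪_ψ X` (`CobordismAttachment b X ψ V`) and let `G₁` be a self-diffeomorphism
of `X` which is the identity on an open neighbourhood of the incoming end `inl(M)`.  Then there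
is a self-diffeomorphism `Φ` of `V` with `Φ ∘ jX = jX ∘ G₁` and `Φ ∘ jW = jW` (the smooth maps
of `exists_contMDiff_apply_jX_eq` for `G₁` and `G₁⁻¹` are mutually inverse).  This is the
pasting `id_W ∪ G₁` used, e.g., in Akbulut–Ruberman (2016), §3, to extend diffeomorphisms of the
cobordism `X` over `V′ = X ∪_f W`. [cite: AkbulutRuberman2016, §3, proof of Thm. A] -/
theorem exists_diffeomorph_apply_jX_eq [CompactSpace W] [CompactSpace M] [T2Space V]
    [IsManifold (𝓡∂ (n + 1)) ∞ V] (A : CobordismAttachment b X ψ V)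
    (G₁ : X.W ≃ₘ⟮𝓡∂ (n + 1), 𝓡∂ (n + 1)⟯ X.W) {U : Set X.W} (hU : IsOpen U)
    (hMU : range X.inl ⊆ U) (hG₁ : ∀ p ∈ U, G₁ p = p) :
    ∃ Φ : V ≃ₘ⟮𝓡∂ (n + 1), 𝓡∂ (n + 1)⟯ V, (∀ x, Φ (A.jX x) = A.jX (G₁ x)) ∧
      ∀ w, Φ (A.jW w) = A.jW w := by
  have hG₁' : ∀ p ∈ U, G₁.symm p = p := fun p hp => by
    conv_lhs => rw [← hG₁ p hp]
    exact G₁.symm_apply_apply p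
  obtain ⟨Φ, hΦs, hΦX, hΦout⟩ := A.exists_contMDiff_apply_jX_eq G₁ hU hMU hG₁
  obtain ⟨Φ', hΦ's, hΦ'X, hΦ'out⟩ := A.exists_contMDiff_apply_jX_eq G₁.symm hU hMU hG₁'
  have h1 : ∀ p, Φ' (Φ p) = p := fun p => by
    by_cases hp : p ∈ range A.jX
    · obtain ⟨x, rfl⟩ := hp
      rw [hΦX, hΦ'X, Diffeomorph.symm_apply_apply]
    · rw [hΦout p hp, hΦ'out p hp]
  have h2 : ∀ p, Φ (Φ' p) = p := fun p => by
    by_cases hp : p ∈ range A.jX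
    · obtain ⟨x, rfl⟩ := hp
      rw [hΦ'X, hΦX, Diffeomorph.apply_symm_apply]
    · rw [hΦ'out p hp, hΦout p hp]
  refine ⟨{ toFun := Φ, invFun := Φ', left_inv := h1, right_inv := h2,
            contMDiff_toFun := hΦs, contMDiff_invFun := hΦ's }, hΦX, fun w => ?_⟩
  show Φ (A.jW w) = A.jW w
  by_cases hw : A.jW w ∈ range A.jX
  · obtain ⟨x, hx⟩ := hw
    obtain ⟨z, -, rfl⟩ := (A.jW_eq_jX_iff w x).1 hx.symm
    rw [← hx, hΦX, hG₁ _ (hMU (mem_range_self _))]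
  · exact hΦout _ hw

end CobordismAttachment

end Literature.Topology.FourManifolds

end
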